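import Summits.PneNP.PneNP.Theorems.ExpanderLinearGeneratorsLinearGeneratorModPFregeHardRandomCount
import Summits.PneNP.PneNP.Theorems.ExpanderLinearGeneratorsLinearGeneratorResolutionSize

/-!
# PneNP / ExpanderLinearGenerators — random sparse pick matrices: the union bound in fraction form

Route `PneNP/ExpanderLinearGenerators`, support for crux stmt-PneNP-11443
(`Summit.PneNP.PneNP.Theses.ExpanderLinearGenerators.LinearGeneratorDepthFregeHard`); the
combinatorial input of `…ExpanderLinearGeneratorsGeneratorRegime` (the generator regime `m = n²`
of the crux, Krajíček's Theorem 13.3.1 / Problem 19.4.5 for random sparse `n² × n` matrices).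
The tree's derandomised count `…LinearGeneratorModPFregeHardRandomCount` codes an `8k`-sparse
`m × n` matrix by a pick function `f : Fin m × Fin (8k) → Fin n` (row `i` supported on
`{f (i, t)}_t`) and bounds the number of pick functions in the "bad boxes" (`card_bad_le`). Here
the count is turned into statements about ALL BUT A SMALL FRACTION of the pick functions, for a
general number of rows `m` and arbitrary right-hand sides:

* `hyps_of_picks` — a cover-expanding pick function gives, for EVERY right-hand side, an
  `8k`-sparse `(R, 3/4 · 8k)`-boundary-expanding system; `exists_system_of_picks_gen` — with an
  unsolvable right-hand side when `n < m`;
* `coverExpanding_of_not_mem_bad` — outside the bad boxes picks are `(R, 7k)`-cover expanding;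
* `card_bad_real_le`, `realSum_le_two_mul`, `card_not_coverExpanding_le` — if every bracket
  `m · e^{7k} · (7ks/n)^k`, `1 ≤ s ≤ R`, is `≤ q ≤ 1/2`, the non-cover-expanding pick functions
  number at most `2q · n^{8km}` (out of `n^{8km}`);
* `exists_coverExpanding_of_brackets` — in particular cover-expanding picks exist when `q < 1/2`.

References: J. Krajíček, *Proof complexity* (CUP 2019), Thm. 13.3.1 [KrajicekProofComplexity2019];
M. Alekhnovich, E. Ben-Sasson, A. A. Razborov, A. Wigderson, SIAM J. Comput. 34 (2004), Thm. 5.1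
[AlekhnovichEtAl2004].
-/

namespace Summit.PneNP.PneNP.Theorems

set_option linter.dupNamespace false -- `Summit.PneNP.PneNP.…`: summit = sub-problem (D-0017)

namespace RandomExpander

open Finset Filter Topology
open Literature.Computability.Complexity Literature.Computability.MetaComplexity

/-! ### Pick matrices: supports and expansion -/

/-- The support of an equation whose coefficient row is the indicator of `S` is `S`. [folklore] -/
theorem supp_eq_of_fst_eq {n : ℕ} {e : LinEqMod 2 n} {S : Finset (Fin n)}
    (he : e.1 = fun j => if j ∈ S then (1 : ZMod 2) else 0) : e.supp = S := by
  ext j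
  simp [LinEqMod.supp, he]

/-- **The system of a cover-expanding pick function satisfies the combinatorial hypotheses of the
crux.** If every nonempty set of `≤ R` rows of `f : Fin m × Fin (8k) → Fin n` covers `> 7k` columns
per row, then any system `E` whose row `i` has coefficient row the indicator of `{f (i, t)}_t`
(and any right-hand sides) is `8k`-sparse and an `(R, 3/4 · 8k)`-boundary expander.
[cite: KrajicekProofComplexity2019, Theorem 13.3.1] -/
theorem hyps_of_picks {k m n R : ℕ} (f : Fin m × Fin (8 * k) → Fin n)
    (hf : ∀ F : Finset (Fin m), F.Nonempty → F.card ≤ R →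
      7 * k * F.card < (F.biUnion fun i => Finset.univ.image fun t => f (i, t)).card)
    (E : Fin m → LinEqMod 2 n)
    (hE : ∀ i, (E i).1 = fun j => if j ∈ (Finset.univ.image fun t => f (i, t)) then 1 else 0) :
    (∀ i, (E i).supp.card ≤ 8 * k) ∧
      IsBoundaryExpander (fun i => (E i).supp.map Fin.valEmbedding) (R : ℝ)
        (3 / 4 * ((8 * k : ℕ) : ℝ)) := by
  -- adapted from `exists_system_of_picks` (m = n + 1 there)
  have hsupp : ∀ i, (E i).supp = Finset.univ.image fun t => f (i, t) :=
    fun i => supp_eq_of_fst_eq (hE i)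
  refine ⟨fun i => ?_, ?_⟩
  · rw [hsupp]
    exact Finset.card_image_le.trans (by simp)
  · have hS : ∀ i : Fin m, (E i).supp.map Fin.valEmbedding
        = (Finset.univ.image fun t => f (i, t)).image (fun j : Fin n => (j : ℕ)) := by
      intro i
      rw [hsupp, Finset.map_eq_image]
      rfl
    simp_rw [hS]
    have hrate : (3 : ℝ) / 4 * ((8 * k : ℕ) : ℝ) = 6 * k := by push_cast; ring
    rw [hrate]
    refine IsCoverExpander.isBoundaryExpander (k := 8 * k)
      (fun i => Finset.card_image_le.trans (Finset.card_image_le.trans (by simp))) ?_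
    intro F hF
    have hrate' : (((8 * k : ℕ) : ℝ) + 6 * k) / 2 = 7 * k := by push_cast; ring
    rw [hrate']
    rcases F.eq_empty_or_nonempty with rfl | hne
    · simp
    · have hFR : F.card ≤ R := by exact_mod_cast hF
      have hlt := hf F hne hFR
      have hcov : (cover (fun i => (Finset.univ.image fun t => f (i, t)).image
          (fun j : Fin n => (j : ℕ))) F).card
          = (F.biUnion fun i => Finset.univ.image fun t => f (i, t)).card := by
        rw [cover, ← Finset.biUnion_image, Finset.card_image_of_injective _ Fin.val_injective]
      rw [hcov]
      exact_mod_cast hlt.le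

/-- **The system of cover-expanding picks with an unsolvable right-hand side** (`n < m`): some
`E : Fin m → LinEqMod 2 n` with the pick supports is `8k`-sparse, `(R, 3/4·8k)`-boundary expanding
and unsolvable. [cite: KrajicekProofComplexity2019, Theorem 13.3.1] -/
theorem exists_system_of_picks_gen {k m n R : ℕ} (hnm : n < m) (f : Fin m × Fin (8 * k) → Fin n)
    (hf : ∀ F : Finset (Fin m), F.Nonempty → F.card ≤ R →
      7 * k * F.card < (F.biUnion fun i => Finset.univ.image fun t => f (i, t)).card) :
    ∃ E : Fin m → LinEqMod 2 n, (∀ i, (E i).supp.card ≤ 8 * k) ∧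
      IsBoundaryExpander (fun i => (E i).supp.map Fin.valEmbedding) (R : ℝ)
        (3 / 4 * ((8 * k : ℕ) : ℝ)) ∧
      ¬ SystemSat E Finset.univ := by
  obtain ⟨b, hb⟩ := exists_rhs_not_systemSat hnm
    (fun i j => if j ∈ (Finset.univ.image fun t => f (i, t)) then (1 : ZMod 2) else 0)
  obtain ⟨hsp, hexp⟩ := hyps_of_picks f hf
    (fun i => (fun j => if j ∈ (Finset.univ.image fun t => f (i, t)) then (1 : ZMod 2) else 0,
      b i)) (fun i => rfl)
  exact ⟨_, hsp, hexp, hb⟩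

/-! ### The union bound in fraction form -/

/-- One term of the union bound (as in `RandomExpander.term_le` of `…RandomInstances`, restated
here to keep this file independent of that module): for `t = 7ks` and `n ≥ 1`,
`C(m,s) · C(n,t) · ((t/n)^s)^{8k} ≤ (m · e^{7k} · (t/n)^k)^s`. [cite: KrajicekProofComplexity2019,
Theorem 13.3.1 (proof)] -/
private theorem term_le_aux (k m s : ℕ) {n t : ℕ} (hn : 0 < n) (ht : t = 7 * k * s) :
    (m.choose s : ℝ) * (n.choose t) * ((((t : ℕ) : ℝ) / n) ^ s) ^ (8 * k)
      ≤ ((m : ℝ) * Real.exp (7 * k) * (((t : ℝ) / n) ^ k)) ^ s := by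
  -- adapted from `RandomExpander.term_le`
  have hn' : (0 : ℝ) < n := by exact_mod_cast hn
  have h1 : (m.choose s : ℝ) ≤ (m : ℝ) ^ s := by exact_mod_cast Nat.choose_le_pow m s
  have h2 : (n.choose t : ℝ) * ((t : ℝ) / n) ^ t ≤ Real.exp (7 * k) ^ s := by
    have hc : (n.choose t : ℝ) ≤ (n : ℝ) ^ t / t.factorial := Nat.choose_le_pow_div t n
    calc (n.choose t : ℝ) * ((t : ℝ) / n) ^ t ≤ ((n : ℝ) ^ t / t.factorial) * ((t : ℝ) / n) ^ t := by
          gcongr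
      _ = (t : ℝ) ^ t / t.factorial := by
          rw [div_pow, div_mul_div_comm, mul_comm ((n : ℝ) ^ t) ((t : ℝ) ^ t),
            mul_div_mul_right _ _ (pow_ne_zero _ hn'.ne')]
      _ ≤ Real.exp t := Real.pow_div_factorial_le_exp (t : ℝ) (Nat.cast_nonneg t) t
      _ = Real.exp (7 * k) ^ s := by
          rw [← Real.exp_nat_mul]
          congr 1
          rw [ht]
          push_cast
          ring
  have h3 : (((t : ℝ) / n) ^ s) ^ (8 * k) = ((t : ℝ) / n) ^ t * ((((t : ℝ) / n) ^ k)) ^ s := by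
    rw [← pow_mul, ← pow_mul, ← pow_add]
    congr 1
    rw [ht]
    ring
  calc (m.choose s : ℝ) * (n.choose t) * ((((t : ℕ) : ℝ) / n) ^ s) ^ (8 * k)
      = (m.choose s : ℝ) * ((n.choose t) * ((t : ℝ) / n) ^ t) * ((((t : ℝ) / n) ^ k)) ^ s := by
        rw [h3]; ring
    _ ≤ (m : ℝ) ^ s * Real.exp (7 * k) ^ s * ((((t : ℝ) / n) ^ k)) ^ s := by
        gcongr
    _ = ((m : ℝ) * Real.exp (7 * k) * (((t : ℝ) / n) ^ k)) ^ s := by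
        rw [mul_pow, mul_pow]

/-- **Outside the bad boxes, picks are cover expanding** (`7kR ≤ n`): a pick function not in any
box of a row set of size `s ∈ [1, R]` and a column set of size `7ks` has every nonempty set of
`≤ R` rows covering `> 7k` columns per row. [cite: KrajicekProofComplexity2019, Theorem 13.3.1
(proof)] -/
theorem coverExpanding_of_not_mem_bad {k m n R : ℕ} (hR : 7 * k * R ≤ n)
    {f : Fin m × Fin (8 * k) → Fin n}
    (hf : f ∉ (Finset.Icc 1 R).biUnion fun s =>
      (Finset.powersetCard s (Finset.univ : Finset (Fin m))).biUnion fun F =>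
        (Finset.powersetCard (7 * k * s) (Finset.univ : Finset (Fin n))).biUnion fun T =>
          Fintype.piFinset fun x : Fin m × Fin (8 * k) => if x.1 ∈ F then T else Finset.univ) :
    ∀ F : Finset (Fin m), F.Nonempty → F.card ≤ R →
      7 * k * F.card < (F.biUnion fun i => Finset.univ.image fun t => f (i, t)).card := by
  -- adapted from `exists_coverExpanding_picks`
  intro F hF hFR
  by_contra hle
  push Not at hle
  apply hf
  have hs : F.card ∈ Finset.Icc 1 R := Finset.mem_Icc.2 ⟨Finset.card_pos.2 hF, hFR⟩
  have h7 : 7 * k * F.card ≤ Fintype.card (Fin n) := by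
    rw [Fintype.card_fin]
    exact (Nat.mul_le_mul_left _ hFR).trans hR
  obtain ⟨T, hT, hTc⟩ := Finset.exists_superset_card_eq hle h7
  simp only [Finset.mem_biUnion, Finset.mem_powersetCard]
  exact ⟨F.card, hs, F, ⟨Finset.subset_univ _, rfl⟩, T, ⟨Finset.subset_univ _, hTc⟩,
    mem_box fun i hi t => hT (Finset.mem_biUnion.2 ⟨i, hi, Finset.mem_image_of_mem _
      (Finset.mem_univ _)⟩)⟩

/-- **The bad boxes in real form**: their total size is at most `n^{8km}` times the real union
bound `Σ_{s=1}^{R} C(m,s) C(n,7ks) ((7ks/n)^s)^{8k}` (`n > 0`). [cite: KrajicekProofComplexity2019,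
Theorem 13.3.1 (proof)] -/
theorem card_bad_real_le (k m n R : ℕ) (hn : 0 < n) :
    ((((Finset.Icc 1 R).biUnion fun s =>
      (Finset.powersetCard s (Finset.univ : Finset (Fin m))).biUnion fun F =>
        (Finset.powersetCard (7 * k * s) (Finset.univ : Finset (Fin n))).biUnion fun T =>
          Fintype.piFinset fun x : Fin m × Fin (8 * k) => if x.1 ∈ F then T else Finset.univ).card
      : ℕ) : ℝ)
      ≤ (n : ℝ) ^ (m * (8 * k)) * ∑ s ∈ Finset.Icc 1 R, (m.choose s : ℝ) * (n.choose (7 * k * s)) *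
          ((((7 * k * s : ℕ) : ℝ) / n) ^ s) ^ (8 * k) := by
  have hn' : (0 : ℝ) < n := by exact_mod_cast hn
  -- adapted from `natSum_lt_of_realSum_lt_one`
  have key : ∀ s ∈ Finset.Icc 1 R,
      (((m.choose s * (n.choose (7 * k * s) * ((7 * k * s) ^ s * n ^ (m - s)) ^ (8 * k))) : ℕ) : ℝ)
        ≤ (n : ℝ) ^ (m * (8 * k)) * ((m.choose s : ℝ) * (n.choose (7 * k * s)) *
            ((((7 * k * s : ℕ) : ℝ) / n) ^ s) ^ (8 * k)) := by
    intro s _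
    rcases le_or_gt s m with hsm | hsm
    · apply le_of_eq
      have hnm : (n : ℝ) ^ (m * (8 * k)) = ((n : ℝ) ^ s) ^ (8 * k) * ((n : ℝ) ^ (m - s)) ^ (8 * k) := by
        rw [← mul_pow, ← pow_add, Nat.add_sub_cancel' hsm, pow_mul]
      rw [hnm, div_pow, div_pow]
      push_cast
      field_simp
      ring
    · rw [Nat.choose_eq_zero_of_lt hsm]
      simp only [zero_mul, Nat.cast_zero]
      positivity
  calc _ ≤ (((∑ s ∈ Finset.Icc 1 R, m.choose s *
        (n.choose (7 * k * s) * ((7 * k * s) ^ s * n ^ (m - s)) ^ (8 * k))) : ℕ) : ℝ) := by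
        exact_mod_cast card_bad_le k m n R
    _ = ∑ s ∈ Finset.Icc 1 R,
          (((m.choose s * (n.choose (7 * k * s) * ((7 * k * s) ^ s * n ^ (m - s)) ^ (8 * k))) : ℕ) : ℝ) := by
        rw [Nat.cast_sum]
    _ ≤ ∑ s ∈ Finset.Icc 1 R, (n : ℝ) ^ (m * (8 * k)) * ((m.choose s : ℝ) * (n.choose (7 * k * s)) *
            ((((7 * k * s : ℕ) : ℝ) / n) ^ s) ^ (8 * k)) := Finset.sum_le_sum key
    _ = _ := by rw [Finset.mul_sum]

/-- **Small brackets make the union bound small**: if every bracket `m · e^{7k} · (7ks/n)^k`,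
`1 ≤ s ≤ R`, is `≤ q` with `0 ≤ q ≤ 1/2`, the real union bound is `≤ 2q` (its `s`-th term is
`≤ q^s`, `term_le`). [cite: KrajicekProofComplexity2019, Theorem 13.3.1 (proof)] -/
theorem realSum_le_two_mul (k m n R : ℕ) (hn : 0 < n) {q : ℝ} (hq0 : 0 ≤ q) (hq1 : q ≤ 1 / 2)
    (hq : ∀ s ∈ Finset.Icc 1 R,
      (m : ℝ) * Real.exp (7 * k) * ((((7 * k * s : ℕ) : ℝ) / n) ^ k) ≤ q) :
    ∑ s ∈ Finset.Icc 1 R, (m.choose s : ℝ) * (n.choose (7 * k * s)) *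
      ((((7 * k * s : ℕ) : ℝ) / n) ^ s) ^ (8 * k) ≤ 2 * q := by
  calc ∑ s ∈ Finset.Icc 1 R, (m.choose s : ℝ) * (n.choose (7 * k * s)) *
        ((((7 * k * s : ℕ) : ℝ) / n) ^ s) ^ (8 * k)
      ≤ ∑ s ∈ Finset.Icc 1 R, q ^ s :=
        Finset.sum_le_sum fun s hs =>
          (term_le_aux k m s hn rfl).trans (pow_le_pow_left₀ (by positivity) (hq s hs) s)
    _ ≤ q ^ 1 / (1 - q) := by
        rw [← Finset.Ico_add_one_right_eq_Icc]
        exact geom_sum_Ico_le_of_lt_one hq0 (by linarith)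
    _ ≤ 2 * q := by
        rw [pow_one, div_le_iff₀ (by linarith)]
        nlinarith

/-- **All but a `2q`-fraction of the pick functions are cover expanding** (`7kR ≤ n`, brackets
`≤ q ≤ 1/2`): the pick functions `f : Fin m × Fin (8k) → Fin n` for which some nonempty set of
`≤ R` rows covers `≤ 7k` columns per row number at most `2q · n^{8km}` (`n^{8km}` being the
number of all pick functions). [cite: KrajicekProofComplexity2019, Theorem 13.3.1] -/
theorem card_not_coverExpanding_le (k m n R : ℕ) (hn : 0 < n) (hR : 7 * k * R ≤ n) {q : ℝ}
    (hq0 : 0 ≤ q) (hq1 : q ≤ 1 / 2)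
    (hq : ∀ s ∈ Finset.Icc 1 R,
      (m : ℝ) * Real.exp (7 * k) * ((((7 * k * s : ℕ) : ℝ) / n) ^ k) ≤ q) :
    ((Finset.univ.filter fun f : Fin m × Fin (8 * k) → Fin n =>
        ¬ ∀ F : Finset (Fin m), F.Nonempty → F.card ≤ R →
          7 * k * F.card < (F.biUnion fun i => Finset.univ.image fun t => f (i, t)).card).card : ℝ)
      ≤ 2 * q * (n : ℝ) ^ (m * (8 * k)) := by
  classical
  set Bad := (Finset.Icc 1 R).biUnion fun s =>
    (Finset.powersetCard s (Finset.univ : Finset (Fin m))).biUnion fun F =>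
      (Finset.powersetCard (7 * k * s) (Finset.univ : Finset (Fin n))).biUnion fun T =>
        Fintype.piFinset fun x : Fin m × Fin (8 * k) => if x.1 ∈ F then T else Finset.univ
    with hBad
  have hsub : (Finset.univ.filter fun f : Fin m × Fin (8 * k) → Fin n =>
      ¬ ∀ F : Finset (Fin m), F.Nonempty → F.card ≤ R →
        7 * k * F.card < (F.biUnion fun i => Finset.univ.image fun t => f (i, t)).card) ⊆ Bad := by
    intro f hf
    rw [Finset.mem_filter] at hf
    by_contra hfB
    exact hf.2 (coverExpanding_of_not_mem_bad hR (by rw [hBad] at hfB; exact hfB))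
  calc _ ≤ ((Bad.card : ℕ) : ℝ) := by exact_mod_cast Finset.card_le_card hsub
    _ ≤ (n : ℝ) ^ (m * (8 * k)) * ∑ s ∈ Finset.Icc 1 R, (m.choose s : ℝ) * (n.choose (7 * k * s)) *
          ((((7 * k * s : ℕ) : ℝ) / n) ^ s) ^ (8 * k) := by
        rw [hBad]; exact card_bad_real_le k m n R hn
    _ ≤ (n : ℝ) ^ (m * (8 * k)) * (2 * q) :=
        mul_le_mul_of_nonneg_left (realSum_le_two_mul k m n R hn hq0 hq1 hq) (by positivity)
    _ = 2 * q * (n : ℝ) ^ (m * (8 * k)) := by ring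

/-- **Cover-expanding pick functions exist once the brackets are `< 1/2`** (`7kR ≤ n`): then
the non-expanding pick functions are fewer than all of them. [cite: KrajicekProofComplexity2019,
Theorem 13.3.1] -/
theorem exists_coverExpanding_of_brackets (k m n R : ℕ) (hn : 0 < n) (hR : 7 * k * R ≤ n) {q : ℝ}
    (hq0 : 0 ≤ q) (hq1 : q < 1 / 2)
    (hq : ∀ s ∈ Finset.Icc 1 R,
      (m : ℝ) * Real.exp (7 * k) * ((((7 * k * s : ℕ) : ℝ) / n) ^ k) ≤ q) :
    ∃ f : Fin m × Fin (8 * k) → Fin n, ∀ F : Finset (Fin m), F.Nonempty → F.card ≤ R →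
      7 * k * F.card < (F.biUnion fun i => Finset.univ.image fun t => f (i, t)).card := by
  classical
  have hlt : ((Finset.univ.filter fun f : Fin m × Fin (8 * k) → Fin n =>
      ¬ ∀ F : Finset (Fin m), F.Nonempty → F.card ≤ R →
        7 * k * F.card < (F.biUnion fun i => Finset.univ.image fun t => f (i, t)).card).card : ℝ)
      < ((Finset.univ : Finset (Fin m × Fin (8 * k) → Fin n)).card : ℝ) := by
    have htot : ((Finset.univ : Finset (Fin m × Fin (8 * k) → Fin n)).card : ℝ)
        = (n : ℝ) ^ (m * (8 * k)) := by
      rw [Finset.card_univ, Fintype.card_fun, Fintype.card_prod, Fintype.card_fin, Fintype.card_fin,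
        Fintype.card_fin]
      push_cast
      ring
    have hpos : (0 : ℝ) < (n : ℝ) ^ (m * (8 * k)) := by positivity
    calc _ ≤ 2 * q * (n : ℝ) ^ (m * (8 * k)) := card_not_coverExpanding_le k m n R hn hR hq0 hq1.le hq
      _ < 1 * (n : ℝ) ^ (m * (8 * k)) := by gcongr; linarith
      _ = _ := by rw [one_mul, htot]
  have hlt' := (Nat.cast_lt (α := ℝ)).1 hlt
  obtain ⟨f, -, hf⟩ := Finset.exists_mem_notMem_of_card_lt_card hlt'
  refine ⟨f, ?_⟩
  by_contra hce
  exact hf (Finset.mem_filter.2 ⟨Finset.mem_univ _, hce⟩)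

end RandomExpander

end Summit.PneNP.PneNP.Theorems
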